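import Literature.NumberTheory.Automorphic.CuspidalCohomologyArchCoeff
import Literature.NumberTheory.Automorphic.GKTensorCohomologySums
import Literature.NumberTheory.Automorphic.HeckeUnramifiedLevelLocal
import Literature.NumberTheory.Automorphic.CompletedCohomologyHeckeAlgebraGLnHolds
import Literature.NumberTheory.Automorphic.LocalComponentBJExistsProofs
import HarnessLib

/-!
# Hecke operators on `H^q(𝔤, K_∞; π ⊗ E_wt(ℂ))` at good places are `H^q` of sums of translations

Topic `NumberTheory/Automorphic`; namespace `Literature.NumberTheory.Automorphic.CuspidalAutomorphicRepData`
(as `CuspidalCohomologyArchCoeff`).  Theorems only (no definition, no named fact, no `sorry`).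

For a cuspidal automorphic representation `π` of `GL_n(𝔸_F)` (`CuspidalAutomorphicRepData n F hcpt`),
a weight `wt`, a level `U ≤ GL_n(𝔸_F^∞)` and a finite place `w` at which `U` is unramified
(`ArithmeticQuotient.IsUnramifiedLevel (GL_n(𝒪_w)) ι_w (·)_w U`; all but finitely many `w` for `U`
open compact, `BigHeckeGLn.exists_goodPlaces`), the Hecke operator `T_{w,j} = [U t_{w,j} U]` on the
`U`-invariant classes of `H^q(𝔤, K_∞; π ⊗ E_wt(ℂ))` (`heckeTWt` of `CuspidalCohomologyArchCoeff`) is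

* `heckeTWt_eq_sum_local` — the LOCAL double-coset sum `T_{w,j} ξ = ∑_{y ∈ s} r(ι_w y) ξ` over a
  transversal `s` of `GL_n(𝒪_w) t GL_n(𝒪_w) / GL_n(𝒪_w)` (`ι_w(t) = t_{w,j}`,
  `BigHeckeGLn.heckeElement_eq_ofLocal`; `HeckeUnramifiedLevelLocal`);
* `cohomologyWtRep_ofLocal` — `r(ι_w y)` acts on cohomology by `H^q(r(ι_w y) ⊗ 1)`, `r` the right
  translation on `π = W / W'` (`AutomorphicRepData.finiteRep`; `GLn.ofFinite_sndHom_ofLocal`);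
* `heckeTWt_eq_rTensorCohomologyHom_sum` — hence **`T_{w,j} ξ = H^q(A ⊗ 1) ξ` with
  `A = ∑_{y ∈ s} r(ι_w y)` the same sum of translations acting on `W / W'`**
  (`GKTensor.sum_rTensorCohomologyHom`).

This is the cohomological half of the identification of the Hecke eigenvalues of cuspidal
cohomology classes with Satake parameters (Harder 1987, §3; Borel–Wallach I §5.1): on the forms
side `A` is the classical Hecke operator `[K(𝔫) t_{w,j}(ϖ) K(𝔫)]` on `K(𝔫)`-invariant forms
(`heckeOperator_comp_apply` along `GLn.ofFinite`), which acts by the Satake eigenvalue modulo `W'`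
(`AutomorphicRepsGLSatakeScalars`).

## References
* [Harder1987] G. Harder, *Eisenstein cohomology of arithmetic groups. The case GL₂*, §3.
* [KhareThorne2017] C. Khare, J. Thorne, Amer. J. Math. 139 (2017), §6.2.
* [BorelWallach2000] A. Borel, N. Wallach, 2nd ed., AMS 2000, I §5.1.
-/

noncomputable section

namespace Literature.NumberTheory.Automorphic

open Module Literature.Algebra.Lie
open scoped TensorProduct

-- Mathlib idiom (as in `GKModules`): commutator bracket on `Module.End`
attribute [local instance 100] LieRing.ofAssociativeRing

/- [extends Literature/NumberTheory/Automorphic/CuspidalCohomologyArchCoeff]: the Hecke operators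
`heckeTWt` at good places. -/

namespace CuspidalAutomorphicRepData

open RealMatrixGroup ParallelWeight MulAction
open scoped MatrixGroups Classical
open scoped _root_.NumberField

variable {F : Type} [Field F] [NumberField F] {n : ℕ} {hcpt : isCompact_glFiniteIntegralLevel n F}
  (π : CuspidalAutomorphicRepData n F hcpt) (wt : Fin n → ℤ)
  (U : Subgroup (BigHeckeGLn.FiniteAdelicGL n F))

/-- **`T_{w,j}` at a good place is the local double-coset sum** on `U`-invariant classes:
`T_{w,j} ξ = ∑_{y ∈ s} r(ι_w y) ξ` for a transversal `s` of `GL_n(𝒪_w) t GL_n(𝒪_w) / GL_n(𝒪_w)`,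
`ι_w(t) = t_{w,j}` (`BigHeckeGLn.heckeElement_eq_ofLocal`), when `U` is unramified at `w`. [cite: KhareThorne2017, §6.2] -/
theorem heckeTWt_eq_sum_local (q : ℕ) (w : IsDedekindDomain.HeightOneSpectrum (𝓞 F)) (j : ℕ)
    (hU : ArithmeticQuotient.IsUnramifiedLevel
      (valuedCongruenceSubgroup (Fin n) (1 : WithZero (Multiplicative ℤ)))
      (BigHeckeGLn.ofLocal n F w) (BigHeckeGLn.localComponent n F w) U)
    (t : GL (Fin n) (w.adicCompletion F))
    (ht : BigHeckeGLn.ofLocal n F w t = BigHeckeGLn.heckeElement n F w j)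
    (s : Finset (GL (Fin n) (w.adicCompletion F)))
    (hs : Set.BijOn
      (fun y : GL (Fin n) (w.adicCompletion F) =>
        (y : GL (Fin n) (w.adicCompletion F) ⧸
          valuedCongruenceSubgroup (Fin n) (1 : WithZero (Multiplicative ℤ))))
      s (orbit (valuedCongruenceSubgroup (Fin n) (1 : WithZero (Multiplicative ℤ)) :
          Subgroup (GL (Fin n) (w.adicCompletion F)))
        (t : GL (Fin n) (w.adicCompletion F) ⧸
          (valuedCongruenceSubgroup (Fin n) (1 : WithZero (Multiplicative ℤ)) :
            Subgroup (GL (Fin n) (w.adicCompletion F))))))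
    {ξ : π.cohomologyWt wt q} (hξ : ξ ∈ π.cohomologyWtLevel wt U q) :
    π.heckeTWt wt U q w j ξ = ∑ y ∈ s, π.cohomologyWtRep wt q (BigHeckeGLn.ofLocal n F w y) ξ := by
  have key := hU.heckeOperator_apply_eq_sum_local (π.cohomologyWtRep wt q) t s hs hξ
  have e : heckeOperator (π.cohomologyWtRep wt q) U (BigHeckeGLn.heckeElement n F w j) =
      heckeOperator (π.cohomologyWtRep wt q) U (BigHeckeGLn.ofLocal n F w t) :=
    congrArg (heckeOperator (π.cohomologyWtRep wt q) U) ht.symm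
  exact (LinearMap.congr_fun e ξ).trans key

/-- `ι_w(y) ∈ G(𝔸_f)` (the range of `GLn.ofFinite`). [folklore] -/
theorem ofLocal_mem_finiteAdelic (w : IsDedekindDomain.HeightOneSpectrum (𝓞 F))
    (y : GL (Fin n) (w.adicCompletion F)) :
    GLn.ofLocal n F w y ∈ (AutomorphyDatum.gl n F hcpt).finiteAdelic :=
  ⟨BigHeckeGLn.ofLocal n F w y, GLn.ofFinite_sndHom_ofLocal w y⟩

/-- **The action of `ι_w(y)` on `H^q(𝔤, K_∞; π ⊗ E_wt(ℂ))` is `H^q(r(ι_w y) ⊗ 1)`.** [folklore] -/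
theorem cohomologyWtRep_ofLocal (q : ℕ) (w : IsDedekindDomain.HeightOneSpectrum (𝓞 F))
    (y : GL (Fin n) (w.adicCompletion F)) :
    π.cohomologyWtRep wt q (BigHeckeGLn.ofLocal n F w y) =
      GKTensor.rTensorCohomologyHom (archGroupGL n F) π.1.kRep π.1.lieRep
        (restrictK (archGroupGL n F) (archCoeffRep F n wt)) (archCoeffLie F n wt)
        (π.1.isGKModule_of_hasLieAction_holds (AutomorphyDatum.isRegular_gl hcpt)
          π.1.hasLieAction_lieRep).ad_compat
        (isGKModule_archCoeff F n wt).ad_compat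
        (π.1.finiteRep ⟨GLn.ofLocal n F w y, ofLocal_mem_finiteAdelic (hcpt := hcpt) w y⟩)
        (fun X => π.1.finiteRep_comm_of_hasLieAction π.1.hasLieAction_lieRep _ X)
        (fun k => π.1.finiteRep_comm_kRep _ k) q := by
  have h : (⟨GLn.ofFinite n F (BigHeckeGLn.ofLocal n F w y), BigHeckeGLn.ofLocal n F w y, rfl⟩ :
      (AutomorphyDatum.gl n F hcpt).finiteAdelic) =
      ⟨GLn.ofLocal n F w y, ofLocal_mem_finiteAdelic (hcpt := hcpt) w y⟩ :=
    Subtype.ext (GLn.ofFinite_sndHom_ofLocal w y)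
  rw [cohomologyWtRep_apply]
  unfold cohomologyWtRepRange AutomorphicRepData.cohomologyRepWith
  rw [GKTensor.cohomologyRep_apply_eq]
  exact GKTensor.rTensorCohomologyHom_congr (archGroupGL n F) π.1.kRep π.1.lieRep
    (restrictK (archGroupGL n F) (archCoeffRep F n wt)) (archCoeffLie F n wt) _ _
    (congrArg π.1.finiteRep h) _ _ _ _ q

/-- **`T_{w,j}` at a good place is `H^q` of the sum of translations** `A = ∑_{y ∈ s} r(ι_w y)` on
`π = W / W'`, tensored with `E_wt(ℂ)`. [cite: KhareThorne2017, §6.2] [cite: BorelWallach2000, I §5.1] -/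
theorem heckeTWt_eq_rTensorCohomologyHom_sum (q : ℕ) (w : IsDedekindDomain.HeightOneSpectrum (𝓞 F))
    (j : ℕ)
    (hU : ArithmeticQuotient.IsUnramifiedLevel
      (valuedCongruenceSubgroup (Fin n) (1 : WithZero (Multiplicative ℤ)))
      (BigHeckeGLn.ofLocal n F w) (BigHeckeGLn.localComponent n F w) U)
    (t : GL (Fin n) (w.adicCompletion F))
    (ht : BigHeckeGLn.ofLocal n F w t = BigHeckeGLn.heckeElement n F w j)
    (s : Finset (GL (Fin n) (w.adicCompletion F)))
    (hs : Set.BijOn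
      (fun y : GL (Fin n) (w.adicCompletion F) =>
        (y : GL (Fin n) (w.adicCompletion F) ⧸
          valuedCongruenceSubgroup (Fin n) (1 : WithZero (Multiplicative ℤ))))
      s (orbit (valuedCongruenceSubgroup (Fin n) (1 : WithZero (Multiplicative ℤ)) :
          Subgroup (GL (Fin n) (w.adicCompletion F)))
        (t : GL (Fin n) (w.adicCompletion F) ⧸
          (valuedCongruenceSubgroup (Fin n) (1 : WithZero (Multiplicative ℤ)) :
            Subgroup (GL (Fin n) (w.adicCompletion F))))))
    {ξ : π.cohomologyWt wt q} (hξ : ξ ∈ π.cohomologyWtLevel wt U q) :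
    π.heckeTWt wt U q w j ξ =
      GKTensor.rTensorCohomologyHom (archGroupGL n F) π.1.kRep π.1.lieRep
        (restrictK (archGroupGL n F) (archCoeffRep F n wt)) (archCoeffLie F n wt)
        (π.1.isGKModule_of_hasLieAction_holds (AutomorphyDatum.isRegular_gl hcpt)
          π.1.hasLieAction_lieRep).ad_compat
        (isGKModule_archCoeff F n wt).ad_compat
        (∑ y ∈ s, π.1.finiteRep ⟨GLn.ofLocal n F w y, ofLocal_mem_finiteAdelic (hcpt := hcpt) w y⟩)
        (sum_comm𝔤 (archGroupGL n F) π.1.lieRep π.1.lieRep s _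
          fun _ X => π.1.finiteRep_comm_of_hasLieAction π.1.hasLieAction_lieRep _ X)
        (sum_commK (archGroupGL n F) π.1.kRep π.1.kRep s _ fun _ k => π.1.finiteRep_comm_kRep _ k)
        q ξ := by
  rw [π.heckeTWt_eq_sum_local wt U q w j hU t ht s hs hξ]
  simp only [cohomologyWtRep_ofLocal]
  exact GKTensor.sum_rTensorCohomologyHom (archGroupGL n F) π.1.kRep π.1.lieRep
    (restrictK (archGroupGL n F) (archCoeffRep F n wt)) (archCoeffLie F n wt) _ _ s _ _ _ q ξ

end CuspidalAutomorphicRepData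

end Literature.NumberTheory.Automorphic

end
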